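import Summits.AtomisticToContinuum.BoseEinsteinCondensation.Theorems.BECInfDivCoherenceGridInfDivCoherenceFreeRegionLatticeRelocate
import Literature.MathematicalPhysics.QuantumManyBody.LeeHuangYangRiemannSum
import Mathlib.Topology.Connected.PathConnected
import HarnessLib

/-!
# Crux `GridInfDivCoherence` (stmt-AtomisticToContinuum-9114), line `registered`: sub-goal (D2') of the dilute
# hard-sphere connectivity statement — matching two lattice configurations by single-particle relocations

The free region of `N` hard spheres with exclusion distance `b` on the torus `ℝ³/Lℤ³`, written on `(ℝ³)^N` with all
lattice images, is `F = {X | ∀ i ≠ j, ∀ n ∈ ℤ³, b < ‖X i - X j - L n‖}`. Write `s = L/M` (`M ≥ 1`, `2bM < L`, i.e.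
`2b < s`). A *lattice configuration* is a configuration `T` on the lattice `sℤ³` all of whose image pair distances are
`≥ s`. We show (`freeRegion_latticeConfigs_joined_of_relocate`, the registered signature): IF in every lattice
configuration any one particle may be moved inside `F`, the others staying put, to any point of `sℤ³` all of whose
`Lℤ³`-images are at distance `≥ s` from the other particles (the single-particle relocation, sub-goal (D2a),
`freeRegion_lattice_relocate` of `…FreeRegionLatticeRelocate.lean`), THEN any two lattice configurations `T`, `T'`
are joined inside `F` up to a relabelling: `T` is joined to `T' ∘ σ` for some permutation `σ`. The unconditional
statement (sub-goal (D2), `freeRegion_latticeConfigs_joined`) follows by feeding in (D2a).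

Proof (namespace `FreeRegionMatching`; purely combinatorial, no auxiliary definitions).
* Since `L = sM`, every image `T j + L n` of a point of `sℤ³` is a point of `sℤ³`, and a nonzero vector of `sℤ³` has
  norm `≥ s` (some coordinate is a nonzero integer multiple of `s`; the tree's `le_norm_latticeVec_of_ne_zero` of
  `LeeHuangYangRiemannSum.lean`). Hence for `p, w ∈ sℤ³` the metric condition
  "`∀ n, s ≤ ‖p - w - L n‖`" follows from the algebraic one "`∀ n, p - w - L n ≠ 0`" (`p ≢ w (mod Lℤ³)`)
  (`le_norm_sub_sub_latticeVec`); conversely (`s > 0`) the points of a lattice configuration are pairwise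
  inequivalent mod `Lℤ³`, in particular pairwise distinct.
* *A free target exists* (`exists_free_target`): for every particle `i`, some point `T' j` of the target
  configuration is inequivalent mod `Lℤ³` to every `T l`, `l ≠ i` — otherwise each of the `N` points `T' j` is
  equivalent to one of the `N - 1` points `T l`, `l ≠ i`, two of them to the same one (pigeonhole, as "a self-map of
  `Fin N` missing `i` is not injective"), hence to each other, contradicting the separation of `T'`.
* *Induction on the defect* `μ(T) = #{l | T l ∉ range T'}` (`exists_perm_joinedIn_of_ncard_le`): if `μ(T) > 0` pick
  `i` with `T i ∉ range T'` and a free target `T' j` for `i`; by the relocation hypothesis `T` is joined in `F` to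
  `T₁ = update T i (T' j)`, which is again a lattice configuration (`forall_le_update`) with
  `{l | T₁ l ∉ range T'} ⊆ {l | T l ∉ range T'} \ {i}`, so `μ(T₁) < μ(T)`. If `μ(T) = 0` then `range T ⊆ range T'`;
  choosing `f l` with `T' (f l) = T l` gives an injective (as `T` is) self-map of `Fin N`, hence a permutation `σ`
  with `T' ∘ σ = T`, and `T ∈ F` is joined to itself. The moves are chained with `JoinedIn.trans`.

References: folklore (motion planning / token relocation in configuration spaces of hard spheres, e.g.
Baryshnikov–Bubenik–Kahle, *Min-type Morse theory for configuration spaces of hard spheres*, IMRN 2014, §2);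
Mathlib's `Finite.injective_iff_surjective`, `Finite.injective_iff_bijective`, `Equiv.ofBijective`,
`Set.ncard_sdiff_singleton_of_mem`, `JoinedIn.trans`; the tree's `le_norm_latticeVec_of_ne_zero`
(`LeeHuangYangRiemannSum.lean`) and `latticeVec_apply/_sub/_neg/_zero` (`PeriodicBoseGas(Lemma32).lean`).
-/

noncomputable section

namespace Summit.AtomisticToContinuum.BoseEinsteinCondensation.Theorems

open Filter Literature.MathematicalPhysics.QuantumManyBody Literature.MathematicalPhysics.QuantumManyBody.BoseGas

namespace FreeRegionMatching

variable {N : ℕ} {L : ℝ}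

/-! ### Inequivalent lattice points are separated -/

/-- If `L = sM`, the difference of two points of `sℤ³` minus a vector of `Lℤ³` is a point of `sℤ³`. [folklore] -/
theorem latticeVec_sub_sub_latticeVec {M : ℕ} {s : ℝ} (hL : L = s * M) (zp zw n : Fin 3 → ℤ) :
    latticeVec s zp - latticeVec s zw - latticeVec L n =
      latticeVec s (fun k => zp k - zw k - (M : ℤ) * n k) := by
  ext k
  simp only [PiLp.sub_apply, latticeVec_apply, hL]
  push_cast
  ring

/-- **Inequivalent lattice points are metrically separated.** For `p, w ∈ sℤ³`, `L = sM`, `s ≥ 0`: if no image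
`w + L n` of `w` equals `p` (`p ≢ w (mod Lℤ³)`), then every image of `w` is at distance `≥ s` from `p`. [folklore] -/
theorem le_norm_sub_sub_latticeVec {M : ℕ} {s : ℝ} (hs : 0 ≤ s) (hL : L = s * M) {p w : Space}
    (hp : ∃ z : Fin 3 → ℤ, p = latticeVec s z) (hw : ∃ z : Fin 3 → ℤ, w = latticeVec s z)
    (h : ∀ n : Fin 3 → ℤ, p - w - latticeVec L n ≠ 0) (n : Fin 3 → ℤ) : s ≤ ‖p - w - latticeVec L n‖ := by
  obtain ⟨zp, rfl⟩ := hp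
  obtain ⟨zw, rfl⟩ := hw
  have hn := h n
  rw [latticeVec_sub_sub_latticeVec hL zp zw n] at hn ⊢
  refine le_norm_latticeVec_of_ne_zero hs fun hz => hn ?_
  rw [hz, latticeVec_zero]

/-- The points of a configuration with image pair distances `≥ s > 0` are pairwise distinct. [folklore] -/
theorem injective_of_forall_le {s : ℝ} (hs : 0 < s) {T : Config N}
    (hT : ∀ a c : Fin N, a ≠ c → ∀ n : Fin 3 → ℤ, s ≤ ‖T a - T c - latticeVec L n‖) :
    Function.Injective T := by
  intro a c hac
  by_contra hne
  have h := hT a c hne 0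
  rw [latticeVec_zero, sub_zero, hac, sub_self, norm_zero] at h
  linarith

/-! ### A free target exists (pigeonhole) -/

/-- **A free target exists.** If the `N` points of `T'` are pairwise at image distance `≥ s > 0` (hence pairwise
inequivalent mod `Lℤ³`), then for every particle `i` some `T' j` is inequivalent mod `Lℤ³` to all the `N - 1` points
`T l`, `l ≠ i`: otherwise two distinct `T' j`, `T' j'` are equivalent to the same `T l` (a self-map of `Fin N`
avoiding the value `i` is not surjective, hence not injective), hence to each other. [folklore] -/
theorem exists_free_target {s : ℝ} (hs : 0 < s) (T : Config N) {T' : Config N} (i : Fin N)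
    (hT' : ∀ a c : Fin N, a ≠ c → ∀ n : Fin 3 → ℤ, s ≤ ‖T' a - T' c - latticeVec L n‖) :
    ∃ j : Fin N, ∀ l : Fin N, l ≠ i → ∀ n : Fin 3 → ℤ, T' j - T l - latticeVec L n ≠ 0 := by
  by_contra H
  push Not at H
  choose g hgi n hn using H
  have hns : ¬ Function.Surjective g := fun hsurj => by
    obtain ⟨j, hj⟩ := hsurj i
    exact hgi j hj
  have hni : ¬ Function.Injective g := fun hinj => hns (Finite.injective_iff_surjective.1 hinj)
  unfold Function.Injective at hni
  push Not at hni
  obtain ⟨j, j', hg, hjj'⟩ := hni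
  have key : T' j - T' j' - latticeVec L (n j - n j') =
      (T' j - T (g j) - latticeVec L (n j)) - (T' j' - T (g j') - latticeVec L (n j')) := by
    rw [hg, latticeVec_sub]
    abel
  have h := hT' j j' hjj' (n j - n j')
  rw [key, hn j, hn j', sub_zero, norm_zero] at h
  linarith

/-! ### Updating one particle -/

/-- Replacing particle `i` of `T` by a point `q` all of whose images are at distance `≥ R` from the other particles
keeps all image pair distances `≥ R` (the pair `(a, i)` is the pair `(i, a)` with the opposite image). [folklore] -/
theorem forall_le_update {R : ℝ} {T : Config N} {i : Fin N} {q : Space}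
    (hT : ∀ a c : Fin N, a ≠ c → ∀ n : Fin 3 → ℤ, R ≤ ‖T a - T c - latticeVec L n‖)
    (hq : ∀ c : Fin N, c ≠ i → ∀ n : Fin 3 → ℤ, R ≤ ‖q - T c - latticeVec L n‖) :
    ∀ a c : Fin N, a ≠ c → ∀ n : Fin 3 → ℤ,
      R ≤ ‖Function.update T i q a - Function.update T i q c - latticeVec L n‖ := by
  intro a c hac n
  by_cases ha : a = i
  · rw [ha] at hac ⊢
    rw [Function.update_self, Function.update_of_ne hac.symm]
    exact hq c hac.symm n
  · rw [Function.update_of_ne ha]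
    by_cases hc : c = i
    · rw [hc, Function.update_self]
      have key : T a - q - latticeVec L n = -(q - T a - latticeVec L (-n)) := by
        rw [latticeVec_neg]; abel
      rw [key, norm_neg]
      exact hq a ha (-n)
    · rw [Function.update_of_ne hc]
      exact hT a c hac n

/-- Replacing one particle of a configuration on `sℤ³` by a point of `sℤ³` gives a configuration on `sℤ³`.
[folklore] -/
theorem forall_exists_update {s : ℝ} {T : Config N} {i : Fin N} {q : Space}
    (hT : ∀ l, ∃ z : Fin 3 → ℤ, T l = latticeVec s z) (hq : ∃ z : Fin 3 → ℤ, q = latticeVec s z) :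
    ∀ l, ∃ z : Fin 3 → ℤ, Function.update T i q l = latticeVec s z := by
  intro l
  by_cases hl : l = i
  · rw [hl, Function.update_self]
    exact hq
  · rw [Function.update_of_ne hl]
    exact hT l

/-- Moving a particle `i` with `T i ∉ range T'` onto a point of `T'` removes `i` from the defect set
`{l | T l ∉ range T'}` and changes nothing else, so the defect drops by at least one. [folklore] -/
theorem ncard_update_le {T T' : Config N} {i : Fin N} (j : Fin N) (hi : T i ∉ Set.range T') {k : ℕ}
    (hk : {l | T l ∉ Set.range T'}.ncard ≤ k + 1) :
    {l | Function.update T i (T' j) l ∉ Set.range T'}.ncard ≤ k := by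
  have hsub : {l | Function.update T i (T' j) l ∉ Set.range T'} ⊆ {l | T l ∉ Set.range T'} \ {i} := by
    intro l hl
    have hli : l ≠ i := by
      rintro rfl
      exact hl (by rw [Function.update_self]; exact Set.mem_range_self j)
    refine ⟨?_, fun h => hli (Set.mem_singleton_iff.1 h)⟩
    have hl' : Function.update T i (T' j) l ∉ Set.range T' := hl
    rw [Function.update_of_ne hli] at hl'
    exact hl'
  have hmem : i ∈ {l | T l ∉ Set.range T'} := hi
  calc {l | Function.update T i (T' j) l ∉ Set.range T'}.ncard
      ≤ ({l | T l ∉ Set.range T'} \ {i}).ncard := Set.ncard_le_ncard hsub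
    _ = {l | T l ∉ Set.range T'}.ncard - 1 := Set.ncard_sdiff_singleton_of_mem hmem
    _ ≤ k := by omega

/-! ### The matching -/

/-- If every point of `T` is a point of `T'` and the points of `T` are pairwise distinct (image pair distances
`≥ s > 0`), then `T = T' ∘ σ` for a permutation `σ` of the labels: an injective self-map of `Fin N` is bijective.
[folklore] -/
theorem exists_perm_comp_eq {s : ℝ} (hs : 0 < s) {T T' : Config N}
    (hT : ∀ a c : Fin N, a ≠ c → ∀ n : Fin 3 → ℤ, s ≤ ‖T a - T c - latticeVec L n‖)
    (h : ∀ l, ∃ j, T' j = T l) : ∃ σ : Equiv.Perm (Fin N), T' ∘ σ = T := by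
  have hinj := injective_of_forall_le hs hT
  choose f hf using h
  have hfinj : Function.Injective f := fun a c hac => hinj (by rw [← hf a, ← hf c, hac])
  exact ⟨Equiv.ofBijective f (Finite.injective_iff_bijective.1 hfinj), funext fun l => hf l⟩

/-- **The matching, by induction on the defect.** Let `F` be any set of configurations containing every
configuration with image pair distances `≥ s` (`s > 0`, `L = sM`), and assume the single-particle relocation into
`F`: in a configuration on `sℤ³` with image pair distances `≥ s`, any particle may be moved inside `F` to any point of
`sℤ³` all of whose images are `≥ s` away from the other particles. Then every such configuration `T` whose defect
`#{l | T l ∉ range T'}` is `≤ k` is joined in `F` to a relabelling of any such configuration `T'`. Induction on `k`: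
relocate a defective particle onto a free target (`exists_free_target`), which lowers the defect; at defect `0`
relabel (`exists_perm_comp_eq`). [folklore] -/
theorem exists_perm_joinedIn_of_ncard_le {M : ℕ} {s : ℝ} (hs : 0 < s) (hL : L = s * M) {F : Set (Config N)}
    (hF : ∀ T : Config N, (∀ a c : Fin N, a ≠ c → ∀ n : Fin 3 → ℤ, s ≤ ‖T a - T c - latticeVec L n‖) → T ∈ F)
    (REL : ∀ T : Config N, (∀ l, ∃ z : Fin 3 → ℤ, T l = latticeVec s z) →
      (∀ a c : Fin N, a ≠ c → ∀ n : Fin 3 → ℤ, s ≤ ‖T a - T c - latticeVec L n‖) →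
      ∀ (i : Fin N) (q : Space), (∃ z : Fin 3 → ℤ, q = latticeVec s z) →
        (∀ l : Fin N, l ≠ i → ∀ n : Fin 3 → ℤ, s ≤ ‖q - T l - latticeVec L n‖) →
        JoinedIn F T (Function.update T i q))
    {T' : Config N} (hT'lat : ∀ l, ∃ z : Fin 3 → ℤ, T' l = latticeVec s z)
    (hT'sep : ∀ a c : Fin N, a ≠ c → ∀ n : Fin 3 → ℤ, s ≤ ‖T' a - T' c - latticeVec L n‖) (k : ℕ) :
    ∀ T : Config N, (∀ l, ∃ z : Fin 3 → ℤ, T l = latticeVec s z) →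
      (∀ a c : Fin N, a ≠ c → ∀ n : Fin 3 → ℤ, s ≤ ‖T a - T c - latticeVec L n‖) →
      {l | T l ∉ Set.range T'}.ncard ≤ k → ∃ σ : Equiv.Perm (Fin N), JoinedIn F T (T' ∘ σ) := by
  induction k with
  | zero =>
    intro T hTlat hTsep hk
    have hempty : {l | T l ∉ Set.range T'} = ∅ := (Set.ncard_eq_zero).1 (Nat.le_zero.1 hk)
    have hmem : ∀ l, ∃ j, T' j = T l := fun l => by
      by_contra hl
      have hl' : l ∈ {l | T l ∉ Set.range T'} := fun ⟨j, hj⟩ => hl ⟨j, hj⟩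
      rw [hempty] at hl'
      exact hl'
    obtain ⟨σ, hσ⟩ := exists_perm_comp_eq hs hTsep hmem
    refine ⟨σ, ?_⟩
    rw [hσ]
    exact JoinedIn.refl (hF T hTsep)
  | succ k ih =>
    intro T hTlat hTsep hk
    by_cases hle : {l | T l ∉ Set.range T'}.ncard ≤ k
    · exact ih T hTlat hTsep hle
    · obtain ⟨i, hi⟩ : {l | T l ∉ Set.range T'}.Nonempty := Set.nonempty_of_ncard_ne_zero (by omega)
      obtain ⟨j, hj⟩ := exists_free_target hs T i hT'sep
      have hq : ∀ l : Fin N, l ≠ i → ∀ n : Fin 3 → ℤ, s ≤ ‖T' j - T l - latticeVec L n‖ := fun l hl =>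
        le_norm_sub_sub_latticeVec hs.le hL (hT'lat j) (hTlat l) (hj l hl)
      have h₁ := REL T hTlat hTsep i (T' j) (hT'lat j) hq
      obtain ⟨σ, h₂⟩ := ih (Function.update T i (T' j)) (forall_exists_update hTlat (hT'lat j))
        (forall_le_update hTsep hq) (ncard_update_le j hi hk)
      exact ⟨σ, h₁.trans h₂⟩

end FreeRegionMatching

/-- **Sub-goal (D2') of the dilute hard-sphere connectivity statement G** (crux `GridInfDivCoherence`, line
`registered`), the combinatorial step: on the torus `ℝ³/Lℤ³` with `2bM < L`, IF in every configuration on the lattice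
`(L/M)ℤ³` with all image pair distances `≥ L/M` any one particle can be moved inside the hard-sphere free region
`F = {X | ∀ i ≠ j, ∀ n ∈ ℤ³, b < ‖X i - X j - L n‖}` to any lattice point all of whose images are at distance `≥ L/M`
from the other particles (sub-goal (D2a)), THEN any two such lattice configurations are joined inside `F` up to a
relabelling of the particles — by induction on the number of particles of `T` not sitting on a point of `T'`: a free
target point of `T'` always exists by pigeonhole over the residues mod `Lℤ³`, and at defect zero the two point sets
agree, so the configurations differ by a permutation. [folklore] -/
theorem freeRegion_latticeConfigs_joined_of_relocate :
    (∀ (N M : ℕ) (L b : ℝ), 0 < M → 0 < b → 2 * b * M < L →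
      ∀ T : Config N, (∀ i, ∃ z : Fin 3 → ℤ, T i = latticeVec (L / M) z) →
        (∀ i j : Fin N, i ≠ j → ∀ n : Fin 3 → ℤ, L / M ≤ ‖T i - T j - latticeVec L n‖) →
        ∀ (i : Fin N) (q : Space), (∃ z : Fin 3 → ℤ, q = latticeVec (L / M) z) →
          (∀ j : Fin N, j ≠ i → ∀ n : Fin 3 → ℤ, L / M ≤ ‖q - T j - latticeVec L n‖) →
          JoinedIn {X : Config N | ∀ i j : Fin N, i ≠ j → ∀ n : Fin 3 → ℤ, b < ‖X i - X j - latticeVec L n‖}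
            T (Function.update T i q)) →
    ∀ (N M : ℕ) (L b : ℝ), 0 < M → 0 < b → 2 * b * M < L →
      ∀ T T' : Config N, (∀ i, ∃ z : Fin 3 → ℤ, T i = latticeVec (L / M) z) →
        (∀ i j : Fin N, i ≠ j → ∀ n : Fin 3 → ℤ, L / M ≤ ‖T i - T j - latticeVec L n‖) →
        (∀ i, ∃ z : Fin 3 → ℤ, T' i = latticeVec (L / M) z) →
        (∀ i j : Fin N, i ≠ j → ∀ n : Fin 3 → ℤ, L / M ≤ ‖T' i - T' j - latticeVec L n‖) →
        ∃ σ : Equiv.Perm (Fin N),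
          JoinedIn {X : Config N | ∀ i j : Fin N, i ≠ j → ∀ n : Fin 3 → ℤ, b < ‖X i - X j - latticeVec L n‖}
            T (T' ∘ σ) := by
  intro REL N M L b hM hb hbML T T' hT hTsep hT' hT'sep
  have REL' := REL N M L b hM hb hbML
  have hMpos : (0 : ℝ) < M := by exact_mod_cast hM
  set s : ℝ := L / M with hs_def
  have hbs : 2 * b < s := by
    rw [hs_def, lt_div_iff₀ hMpos]
    exact hbML
  have hs : 0 < s := by linarith
  have hL : L = s * M := by rw [hs_def, div_mul_cancel₀ L hMpos.ne']
  exact FreeRegionMatching.exists_perm_joinedIn_of_ncard_le hs hL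
    (F := {X : Config N | ∀ i j : Fin N, i ≠ j → ∀ n : Fin 3 → ℤ, b < ‖X i - X j - latticeVec L n‖})
    (fun X hX a c hac n => by linarith [hX a c hac n]) REL' hT' hT'sep _ T hT hTsep le_rfl

/-- **Sub-goal (D2) of the dilute hard-sphere connectivity statement G** (crux `GridInfDivCoherence`, line
`registered`): on the torus `ℝ³/Lℤ³` with `2bM < L`, any two configurations on the lattice `(L/M)ℤ³` with all image
pair distances `≥ L/M` are joined inside the hard-sphere free region
`F = {X | ∀ i ≠ j, ∀ n ∈ ℤ³, b < ‖X i - X j - L n‖}` up to a relabelling of the particles — the combinatorial step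
(D2') fed with the single-particle relocation (D2a), `freeRegion_lattice_relocate`. [folklore] -/
theorem freeRegion_latticeConfigs_joined :
    ∀ (N M : ℕ) (L b : ℝ), 0 < M → 0 < b → 2 * b * M < L →
      ∀ T T' : Config N, (∀ i, ∃ z : Fin 3 → ℤ, T i = latticeVec (L / M) z) →
        (∀ i j : Fin N, i ≠ j → ∀ n : Fin 3 → ℤ, L / M ≤ ‖T i - T j - latticeVec L n‖) →
        (∀ i, ∃ z : Fin 3 → ℤ, T' i = latticeVec (L / M) z) →
        (∀ i j : Fin N, i ≠ j → ∀ n : Fin 3 → ℤ, L / M ≤ ‖T' i - T' j - latticeVec L n‖) →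
        ∃ σ : Equiv.Perm (Fin N),
          JoinedIn {X : Config N | ∀ i j : Fin N, i ≠ j → ∀ n : Fin 3 → ℤ, b < ‖X i - X j - latticeVec L n‖}
            T (T' ∘ σ) :=
  freeRegion_latticeConfigs_joined_of_relocate freeRegion_lattice_relocate

end Summit.AtomisticToContinuum.BoseEinsteinCondensation.Theorems

end
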